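import Literature.NumberTheory.EllipticCurves.FramedTateGaloisRep
import Literature.NumberTheory.EllipticCurves.TateModuleGaloisTransportProofs
import Literature.AlgebraicGeometry.Motives.FaltingsECEndCoreCasesProofs
import Literature.NumberTheory.GaloisRepresentations.OddAbsolutelyIrreducibleProofs
import Literature.RepresentationTheory.Semisimple.BurnsideMatrixSpan
import Literature.RepresentationTheory.Semisimple.SubrepresentationEquiv
import HarnessLib

/-!
# `V_ℓ E` has non-zero traces off `Γ_L` when `L` has a real place

Topic `Literature/NumberTheory/EllipticCurves`; a *proofs* file (theorems only: no definition, no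
named fact, no instance), a brick of the discharge programme of
`Literature.NumberTheory.Automorphic.isModularEllipticCurve_baseChange_rat_of_isSolvable` (cyclic
base change of the automorphic representation of an elliptic curve up a solvable totally real
tower).  The cuspidality clause of Arthur–Clozel's Thm. 4.2 (a) (`baseChange_cyclic_cuspidal`)
at a QUADRATIC step `L / K` asks for a place of `K` inert in `L` at which the trace of
Frobenius is non-zero ("`π ≇ π ⊗ η_{L/K}`", Ribet 1977, §4: `π` has CM by `L` iff `a_v = 0`
at the inert `v`); by the density of Frobenii this comes down to ONE element of `Γ_K` off
`res(Γ_L)` with non-zero trace on `V_ℓ E`, which this file supplies whenever `L` has a real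
place — in the application `L` is totally real, and no open-image or complex-multiplication
input is needed:

* `WeierstrassCurve.exists_trace_rationalGaloisRepTate_ne_zero_of_not_mem_range` — **for an
  elliptic curve `E / K` over a number field, a finite extension `L / K` with a real embedding and
  `res(Γ_L) ≠ Γ_K`, and a prime `ℓ` with `V_ℓ(E ⊗ L)` an irreducible `ℚ_ℓ[Γ_L]`-module, some
  `γ ∈ Γ_K ∖ res(Γ_L)` has `tr(γ | V_ℓ E) ≠ 0`.**

Proof.  A complex conjugation `c ∈ Γ_L` (`exists_isComplexConjugation`) acts on `V_ℓ(E ⊗ L)`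
as an involution of determinant `-1` (`det_rationalGaloisRepTate_of_isComplexConjugation`: Weil
pairing, `det ρ_ℓ = χ_ℓ`, `χ_ℓ(c) = -1`), so the irreducible plane `V_ℓ(E ⊗ L)` is absolutely
irreducible (`FramedRep.isAbsolutelyIrreducible_of_isIrreducible_of_det_eq_neg_one`,
Darmon–Diamond–Taylor 1995, p. 87) and the matrices of `Γ_L` in a basis span `M₂(ℚ_ℓ)`
(Burnside, `span_eq_top_iff_forall_isIrreducible`).  Transporting the basis along
`V_ℓ(E ⊗ L) ≅ V_ℓ(E)|_{Γ_L}` (`exists_rationalTateModule_equiv_baseChange`) these are the matrices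
of `res(h)`, `h ∈ Γ_L`, on `V_ℓ E`.  If every element off `res(Γ_L)` had trace zero then, for a
fixed `γ ∉ res(Γ_L)`, `tr([γ][res h]) = tr [γ res h] = 0` for all `h`, whence `tr([γ] M) = 0`
for all `M ∈ M₂(ℚ_ℓ)` — absurd for `M = [γ]⁻¹`.  (The Galois-side form of "`V_ℓ E` is not
induced from `Γ_L`", i.e. not a self-twist by the quadratic character of `L / K`, for `L` with
a real place; the irreducibility hypothesis is supplied in the application by the elementary
Frobenius criterion of `TateModuleIrreducibleFrobenius`.)

## References

* K. A. Ribet, *Galois representations attached to eigenforms with Nebentypus*, LNM 601 (1977),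
  §4 (Prop. 4.4, Thm. 4.5). [Ribet1977Nebentypus]
* H. Darmon, F. Diamond, R. Taylor, *Fermat's Last Theorem* (1995), Thm. 3.1 (b)–(c) and p. 87.
  [DarmonDiamondTaylor1995]
* C. W. Curtis, I. Reiner, *Representation theory of finite groups and associative algebras*
  (1962), (27.4) (Burnside). [CurtisReiner1962]
* J.-P. Serre, *Abelian ℓ-adic representations and elliptic curves* (1968), Ch. I §1.2, Ch. IV
  §2.2. [SerreAbelianLadic1968]
-/

noncomputable section

open scoped NumberField MatrixGroups Matrix
open Field IsDedekindDomain

universe u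

namespace WeierstrassCurve

open Literature.NumberTheory.EllipticCurves Literature.NumberTheory.GaloisRepresentations
  Literature.RepresentationTheory.Semisimple

variable {K : Type u} [Field K] [NumberField K] (W : WeierstrassCurve K) [W.IsElliptic]
  (L : Type u) [Field L] [NumberField L] [Algebra K L] (ℓ : ℕ) [Fact ℓ.Prime]

/-- **Non-zero traces off an index-two subgroup cutting out a totally real field.**  Let `E / K`
be an elliptic curve over a number field, `L / K` a finite extension admitting a real embedding
`φ : L →+* ℝ`, with `res(Γ_L) ≠ Γ_K`, and `ℓ` a prime such that `V_ℓ(E ⊗ L)` is an irreducible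
`ℚ_ℓ[Γ_L]`-module.  Then some `γ ∈ Γ_K ∖ res(Γ_L)` has `tr(γ | V_ℓ E) ≠ 0`.  Proof: the complex
conjugation `c ∈ Γ_L` attached to `φ` (`exists_isComplexConjugation`) acts on `V_ℓ(E ⊗ L)` as an
involution of determinant `-1` (`det_rationalGaloisRepTate_of_isComplexConjugation`, Weil
pairing and `χ_ℓ(c) = -1`), so the irreducible `V_ℓ(E ⊗ L)` is absolutely irreducible
(`FramedRep.isAbsolutelyIrreducible_of_isIrreducible_of_det_eq_neg_one`, Darmon–Diamond–Taylor
1995, p. 87) and the matrices of `Γ_L` span `M₂(ℚ_ℓ)` (Burnside,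
`span_eq_top_iff_forall_isIrreducible`); as `V_ℓ(E ⊗ L) ≅ V_ℓ(E)|_{Γ_L}`
(`exists_rationalTateModule_equiv_baseChange`), the matrices `[γ res(h)]`, `h ∈ Γ_L`, for a fixed
`γ ∉ res(Γ_L)` would all have trace zero if every element off `res(Γ_L)` did, forcing
`tr([γ] M) = 0` for all `M ∈ M₂(ℚ_ℓ)`, i.e. `[γ] = 0` — absurd (`tr([γ][γ]⁻¹) = 2`).  This is
the Galois-side statement that `V_ℓ E` is not induced from `Γ_L` (is not a self-twist by the
character of `L / K`) when `L` is totally real; cf. Ribet 1977, §4.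
[cite: DarmonDiamondTaylor1995, Thm. 3.1 (b)–(c) and p. 87] [cite: Ribet1977Nebentypus, §4 (Thm. 4.5)] -/
theorem exists_trace_rationalGaloisRepTate_ne_zero_of_not_mem_range (φ : L →+* ℝ)
    (hirr : haveI : (W.baseChange L).IsElliptic := by rw [baseChange]; infer_instance
      ((W.baseChange L).rationalGaloisRepTate ℓ).IsIrreducible)
    (hne : ((absGaloisRestrict K L).range : Subgroup (absoluteGaloisGroup K)) ≠ ⊤) :
    ∃ γ : absoluteGaloisGroup K, γ ∉ (absGaloisRestrict K L).range ∧
      haveI := W.module_finite_rationalTateModule_holds ℓ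
      LinearMap.trace ℚ_[ℓ] _ (W.rationalGaloisRepTate ℓ γ) ≠ 0 := by
  classical
  haveI hEL : (W.baseChange L).IsElliptic := by rw [baseChange]; infer_instance
  haveI := W.module_finite_rationalTateModule_holds ℓ
  haveI := (W.baseChange L).module_finite_rationalTateModule_holds ℓ
  by_contra hcon
  push Not at hcon
  -- `V_ℓ(E ⊗ L) ≅ V_ℓ(E)|_{Γ_L}`
  obtain ⟨eEq, heEq⟩ := W.exists_rationalTateModule_equiv_baseChange L ℓ
  -- bases: `bL` of `V_ℓ(E ⊗ L)`, transported to `bK` of `V_ℓ E`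
  set bL := (W.baseChange L).rationalTateBasis ℓ with hbL
  set bK : Module.Basis (Fin 2) ℚ_[ℓ] (W.rationalTateModule ℓ) := bL.map eEq.symm with hbK
  -- the two frames over `ℚ_ℓ`
  set ρL : FramedRep (absoluteGaloisGroup L) ℚ_[ℓ] 2 :=
    (rationalTateGaloisRepOf (geomPoints (W.baseChange L)) ℓ
      ((W.baseChange L).continuous_rationalGaloisRepTate_holds ℓ)).frame bL with hρL
  set ρK : FramedRep (absoluteGaloisGroup K) ℚ_[ℓ] 2 :=
    (rationalTateGaloisRepOf (geomPoints W) ℓ (W.continuous_rationalGaloisRepTate_holds ℓ)).frame bK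
    with hρK
  -- (1) `ρK (res h) = ρL h`
  have hmat : ∀ h : absoluteGaloisGroup L,
      ((ρK (absGaloisRestrict K L h) : GL (Fin 2) ℚ_[ℓ]) : Matrix (Fin 2) (Fin 2) ℚ_[ℓ]) =
        ((ρL h : GL (Fin 2) ℚ_[ℓ]) : Matrix (Fin 2) (Fin 2) ℚ_[ℓ]) := by
    intro h
    rw [hρK, hρL, ContinuousRep.coe_frame_apply, ContinuousRep.coe_frame_apply]
    ext i j
    rw [LinearMap.toMatrix_apply, LinearMap.toMatrix_apply, hbK, Module.Basis.map_apply,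
      Module.Basis.map_repr, LinearEquiv.symm_symm, LinearEquiv.trans_apply]
    change bL.repr (eEq (W.rationalGaloisRepTate ℓ (absGaloisRestrict K L h) (eEq.symm (bL j)))) i =
      bL.repr ((W.baseChange L).rationalGaloisRepTate ℓ h (bL j)) i
    rw [heEq, LinearEquiv.apply_symm_apply]
  -- (2) `ρL` is irreducible over `ℚ_ℓ`
  have hirrL : FramedRep.IsIrreducible ρL := by
    haveI : (rationalTateGaloisRepOf (geomPoints (W.baseChange L)) ℓ
        ((W.baseChange L).continuous_rationalGaloisRepTate_holds ℓ)).toRepresentation.IsIrreducible :=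
      hirr
    exact Representation.isIrreducible_of_equiv
      ((rationalTateGaloisRepOf (geomPoints (W.baseChange L)) ℓ
        ((W.baseChange L).continuous_rationalGaloisRepTate_holds ℓ)).frameEquiv bL).toRepEquiv.symm
  -- (3) a complex conjugation `c ∈ Γ_L`: `ρL(c)` is an involution of determinant `-1`
  obtain ⟨c, hc⟩ := exists_isComplexConjugation φ
  have hcc : c * c = 1 := by rw [← pow_two]; exact hc.sq_eq_one
  have hdet : Matrix.GeneralLinearGroup.det (ρL c) = -1 := by
    refine Units.ext ?_
    rw [Matrix.GeneralLinearGroup.val_det_apply, hρL, ContinuousRep.coe_frame_apply,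
      LinearMap.det_toMatrix, Units.val_neg, Units.val_one]
    exact Literature.AlgebraicGeometry.Motives.det_rationalGaloisRepTate_of_isComplexConjugation
      (W.baseChange L) ℓ hc
  -- (4) hence `ρL` is absolutely irreducible, and (5) its matrices span `M₂(ℚ_ℓ)` (Burnside)
  have habs : FramedRep.IsAbsolutelyIrreducible ρL :=
    FramedRep.isAbsolutelyIrreducible_of_isIrreducible_of_det_eq_neg_one ρL hirrL two_ne_zero hcc
      hdet
  have hspan : Submodule.span ℚ_[ℓ] (Set.range fun h : absoluteGaloisGroup L ↦
      ((ρL h : GL (Fin 2) ℚ_[ℓ]) : Matrix (Fin 2) (Fin 2) ℚ_[ℓ])) = ⊤ :=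
    (span_eq_top_iff_forall_isIrreducible two_pos ρL.toMonoidHom).mpr fun B _ f ↦ habs B f
  -- (6) the trace argument
  obtain ⟨γ₀, hγ₀⟩ : ∃ γ₀ : absoluteGaloisGroup K, γ₀ ∉ (absGaloisRestrict K L).range := by
    by_contra h'
    push Not at h'
    exact hne (eq_top_iff.2 fun x _ ↦ h' x)
  set A : Matrix (Fin 2) (Fin 2) ℚ_[ℓ] := ((ρK γ₀ : GL (Fin 2) ℚ_[ℓ]) : Matrix (Fin 2) (Fin 2) ℚ_[ℓ])
    with hA
  have key : ∀ h : absoluteGaloisGroup L,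
      Matrix.trace (A * ((ρL h : GL (Fin 2) ℚ_[ℓ]) : Matrix (Fin 2) (Fin 2) ℚ_[ℓ])) = 0 := by
    intro h
    have hh : absGaloisRestrict K L h ∈ (absGaloisRestrict K L).range := ⟨h, rfl⟩
    have hnot : γ₀ * absGaloisRestrict K L h ∉ (absGaloisRestrict K L).range := fun hm ↦
      hγ₀ (((absGaloisRestrict K L).range.mul_mem_cancel_right hh).mp hm)
    rw [← hmat h, hA, ← Units.val_mul, ← map_mul, hρK, ContinuousRep.coe_frame_apply,
      ← LinearMap.trace_eq_matrix_trace ℚ_[ℓ] bK]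
    exact hcon _ hnot
  -- the linear form `M ↦ tr (A M)` kills the spanning set, hence everything
  set T : Matrix (Fin 2) (Fin 2) ℚ_[ℓ] →ₗ[ℚ_[ℓ]] ℚ_[ℓ] :=
    (Matrix.traceLinearMap (Fin 2) ℚ_[ℓ] ℚ_[ℓ]).comp (LinearMap.mulLeft ℚ_[ℓ] A) with hT
  have hTapply : ∀ M, T M = Matrix.trace (A * M) := fun M ↦ rfl
  have hle : Submodule.span ℚ_[ℓ] (Set.range fun h : absoluteGaloisGroup L ↦
      ((ρL h : GL (Fin 2) ℚ_[ℓ]) : Matrix (Fin 2) (Fin 2) ℚ_[ℓ])) ≤ LinearMap.ker T := by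
    refine Submodule.span_le.mpr ?_
    rintro _ ⟨h, rfl⟩
    rw [SetLike.mem_coe, LinearMap.mem_ker, hTapply]
    exact key h
  rw [hspan, top_le_iff] at hle
  have h2 : T (((ρK γ₀)⁻¹ : GL (Fin 2) ℚ_[ℓ]) : Matrix (Fin 2) (Fin 2) ℚ_[ℓ]) = 2 := by
    rw [hTapply, hA, Units.mul_inv, Matrix.trace_one, Fintype.card_fin]
    norm_num
  have h0 : T (((ρK γ₀)⁻¹ : GL (Fin 2) ℚ_[ℓ]) : Matrix (Fin 2) (Fin 2) ℚ_[ℓ]) = 0 := by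
    rw [← LinearMap.mem_ker, hle]
    exact Submodule.mem_top
  rw [h0] at h2
  exact two_ne_zero h2.symm

end WeierstrassCurve
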